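import Literature.Analysis.FluidPDE.PassiveScalarWellPosednessProofs
import Mathlib.Analysis.Calculus.Deriv.Shift
import HarnessLib

/-!
# The forced heat equation on `[a, b] × 𝕋^d`: classical solutions, uniqueness, coefficient ODE

Analysis/FluidPDE support file (all results proved), serving the discharge of the named fact
`Torus.CheskidovLuo2022AntidivergenceBound` (`NavierStokesConcentrationCorrectorFacts`;
Cheskidov–Luo 2022, Prop. 3.2, where the antidivergence of the local corrector is controlled
through the heat flow `∂ₜz - Δz = F`). It repackages the discharged classical well-posedness of
the forced advection–diffusion equation on `𝕋^d`
(`Torus.exists_unique_isClassicalScalarTransportForcedOn_holds`, `PassiveScalarWellPosednessProofs`;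
zero drift, `κ = 1`) on an arbitrary time interval `[a, b]`:

* `Torus.IsSmoothSpaceTimeOn.comp_add_const`, `Torus.timeDerivWithin_comp_add_const` — time
  translation of jointly smooth fields and of the one-sided time derivative;
* `Torus.exists_heatForced_Icc` — for `a < b` and `f` jointly smooth on `[a, b] × 𝕋^d` there is
  `θ` jointly smooth on `[a, b] × 𝕋^d` with `∂ₜθ = Δθ + f` (one-sided time derivative within
  `[a, b]`) and `θ(a) = 0`; `Torus.heatForced_unique_Icc` — two classical solutions with the same
  forcing and the same datum at `a` agree on `[a, b]`;
* `Torus.hasDerivWithinAt_mFourierCoeff_heatForced` — the Fourier coefficients of (the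
  complexification of) a classical solution solve `ĉₖ' = -4π²|k|² ĉₖ + f̂ₖ` within `[a, b]`
  (`d/dt 𝓕(θ(t)) = 𝓕(∂ₜθ(t))`, `𝓕(Δθ) = -4π²|k|²𝓕θ`; Grafakos 2014, Prop. 3.2.6 (8));
* `Torus.IsSmoothSpaceTimeOn.integral_slice` — the spatial mean `t ↦ ∫ θ(t, y) dy` of a jointly
  smooth field is a jointly smooth (space-independent) field on `[a, b]`, so that mean-zero
  normalisations stay classical;
* commutation of `(↑) : ℝ → ℂ` with `∂ⱼ`, `Δ`, `∂ₜ` on torus fields.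

## References

* A. Cheskidov, X. Luo, *Sharp nonuniqueness for the Navier–Stokes equations*, Invent. Math. 229
  (2022) = arXiv:2009.06596, Prop. 3.2 (proof: the heat equation for `z = ℛvᵢ`). [`CheskidovLuo2022`]
* L. C. Evans, *Partial Differential Equations*, 2nd ed. (2010), §2.3.1 (Duhamel), §7.1.2.
  [`Evans2010`]
* L. Grafakos, *Classical Fourier Analysis*, 3rd ed. (2014), Prop. 3.2.6 (8). [`Grafakos2014`]
-/

open MeasureTheory Set Filter Topology
open scoped ENNReal ContDiff InnerProductSpace

noncomputable section

namespace Literature.Analysis.FluidPDE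

namespace Torus

open UnitAddTorus (mFourierCoeff mFourier)
open Literature.Analysis.FunctionSpaces.Torus (proj stLift timeDerivWithin IsSmoothSpaceTimeOn
  IsSmooth laplacian partialDeriv gradient freqNormSq)

variable {d : Type*} [Fintype d]

/-! ## Time translation -/

section Translate

variable {F : Type*} [NormedAddCommGroup F] [NormedSpace ℝ F]

/-- Joint smoothness is invariant under time translation: if `w` is jointly smooth on
`S × 𝕋^d` then `t ↦ w (t + c)` is jointly smooth on `((· + c)⁻¹' S) × 𝕋^d` (torus twin of
`Literature.Analysis.FluidPDE.IsSmoothSpaceTimeOn.comp_add_right`). [folklore] -/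
theorem _root_.Literature.Analysis.FunctionSpaces.Torus.IsSmoothSpaceTimeOn.comp_add_const
    {S : Set ℝ} {w : ℝ → UnitAddTorus d → F} (h : IsSmoothSpaceTimeOn S w) (c : ℝ) :
    IsSmoothSpaceTimeOn ((· + c) ⁻¹' S) (fun t => w (t + c)) := by
  have hφ : ContDiff ℝ ∞ (fun z : ℝ × EuclideanSpace ℝ d => (z.1 + c, z.2)) :=
    (contDiff_fst.add contDiff_const).prodMk contDiff_snd
  have hmaps : MapsTo (fun z : ℝ × EuclideanSpace ℝ d => (z.1 + c, z.2))
      (((· + c) ⁻¹' S) ×ˢ univ) (S ×ˢ univ) := fun z hz => ⟨hz.1, mem_univ _⟩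
  change ContDiffOn ℝ ∞ (stLift w ∘ fun z : ℝ × EuclideanSpace ℝ d => (z.1 + c, z.2))
    (((· + c) ⁻¹' S) ×ˢ univ)
  exact h.comp hφ.contDiffOn hmaps

omit [Fintype d] in
/-- The one-sided time derivative commutes with time translation:
`∂ₜ[w(· + c)]` within `(· + c)⁻¹' S` at `t` is `∂ₜw` within `S` at `t + c`
(Mathlib `derivWithin_comp_add_const`). [folklore] -/
theorem timeDerivWithin_comp_add_const (S : Set ℝ) (w : ℝ → UnitAddTorus d → F) (c t : ℝ)
    (x : UnitAddTorus d) :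
    timeDerivWithin ((· + c) ⁻¹' S) (fun s => w (s + c)) t x = timeDerivWithin S w (t + c) x := by
  simp only [FunctionSpaces.Torus.timeDerivWithin]
  rw [show (fun s => w (s + c) x) = ((fun s => w s x) <| · + c) from rfl,
    derivWithin_comp_add_const (fun s => w s x) c]
  congr 1
  ext s
  simp only [Set.mem_vadd_set, mem_preimage, vadd_eq_add]
  constructor
  · rintro ⟨y, hy, rfl⟩
    rwa [add_comm]
  · intro hs
    exact ⟨s - c, by simpa using hs, by ring⟩

/-- `(· + c)⁻¹' [p, q] = [p - c, q - c]`. [folklore] -/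
theorem preimage_add_const_Icc' (c p q : ℝ) : (· + c) ⁻¹' Icc p q = Icc (p - c) (q - c) := by
  ext s
  simp only [mem_preimage, mem_Icc]
  constructor <;> intro h <;> constructor <;> linarith [h.1, h.2]

end Translate

/-! ## Real-to-complex coercion commutes with the torus derivatives -/

section OfReal

variable [DecidableEq d]

/-- `∂ⱼ (θ : ℂ) = (∂ⱼ θ : ℂ)` for smooth real `θ`. [folklore] -/
theorem partialDeriv_ofReal {θ : UnitAddTorus d → ℝ} (hθ : IsSmooth θ) (j : d) (x : UnitAddTorus d) :
    partialDeriv j (fun y => (θ y : ℂ)) x = ((partialDeriv j θ x : ℝ) : ℂ) := by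
  have h := hθ.hasDerivAt_line_zero j x
  have h2 : HasDerivAt (fun t : ℝ => ((θ (x + proj (t • EuclideanSpace.single j (1 : ℝ))) : ℝ) : ℂ))
      ((partialDeriv j θ x : ℝ) : ℂ) 0 :=
    Complex.ofRealCLM.hasFDerivAt.comp_hasDerivAt (0 : ℝ) h
  exact h2.deriv

/-- `Δ (θ : ℂ) = (Δ θ : ℂ)` for smooth real `θ`. [folklore] -/
theorem laplacian_ofReal {θ : UnitAddTorus d → ℝ} (hθ : IsSmooth θ) (x : UnitAddTorus d) :
    laplacian (fun y => (θ y : ℂ)) x = ((laplacian θ x : ℝ) : ℂ) := by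
  have hθC : IsSmooth (fun y => (θ y : ℂ)) := hθ.comp_clm Complex.ofRealCLM
  rw [FunctionSpaces.Torus.laplacian_eq_sum_partialDeriv_partialDeriv hθC,
    FunctionSpaces.Torus.laplacian_eq_sum_partialDeriv_partialDeriv hθ, Complex.ofReal_sum]
  refine Finset.sum_congr rfl fun i _ => ?_
  have h1 : partialDeriv i (fun y => (θ y : ℂ)) = fun y => ((partialDeriv i θ y : ℝ) : ℂ) :=
    funext fun y => partialDeriv_ofReal hθ i y
  rw [h1, partialDeriv_ofReal (hθ.partialDeriv i)]

omit [DecidableEq d] in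
/-- `∂ₜ (θ : ℂ) = (∂ₜ θ : ℂ)` within `S` for jointly smooth real `θ`. [folklore] -/
theorem timeDerivWithin_ofReal {S : Set ℝ} {θ : ℝ → UnitAddTorus d → ℝ} (hθ : IsSmoothSpaceTimeOn S θ)
    (hS : UniqueDiffOn ℝ S) {t : ℝ} (ht : t ∈ S) (x : UnitAddTorus d) :
    timeDerivWithin S (fun s y => (θ s y : ℂ)) t x = ((timeDerivWithin S θ t x : ℝ) : ℂ) := by
  have h := hθ.hasDerivWithinAt_slice ht x
  have h2 : HasDerivWithinAt (fun s => ((θ s x : ℝ) : ℂ)) ((timeDerivWithin S θ t x : ℝ) : ℂ) S t :=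
    Complex.ofRealCLM.hasFDerivAt.comp_hasDerivWithinAt t h
  exact h2.derivWithin (hS t ht)

omit [DecidableEq d] in
/-- The complexification of a jointly smooth real field is jointly smooth. [folklore] -/
theorem _root_.Literature.Analysis.FunctionSpaces.Torus.IsSmoothSpaceTimeOn.ofReal {S : Set ℝ}
    {θ : ℝ → UnitAddTorus d → ℝ} (hθ : IsSmoothSpaceTimeOn S θ) :
    IsSmoothSpaceTimeOn S (fun s y => (θ s y : ℂ)) :=
  hθ.clm_comp Complex.ofRealCLM

omit [DecidableEq d] in
/-- The Fourier coefficients of the zero function vanish. [folklore] -/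
theorem mFourierCoeff_zero_fun (k : d → ℤ) :
    mFourierCoeff (fun _ : UnitAddTorus d => (0 : ℂ)) k = 0 := by
  rw [FunctionSpaces.Torus.mFourierCoeff_eq_integral_volume]
  simp

end OfReal

/-! ## Classical solutions of the forced heat equation on `[a, b]` -/

section Heat

variable [DecidableEq d]

/-- **Existence for the forced heat equation on `[a, b] × 𝕋^d`.** For `a < b` and `f` jointly
smooth on `[a, b] × 𝕋^d` there is `θ` jointly smooth on `[a, b] × 𝕋^d` with `∂ₜθ = Δθ + f`
pointwise (one-sided time derivative within `[a, b]`) and `θ(a) = 0` (the discharged fact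
`Torus.exists_unique_isClassicalScalarTransportForcedOn` with zero drift and `κ = 1`, translated
from `[0, b - a]` to `[a, b]`; Evans 2010, §2.3.1 Thm. 2 for the Duhamel solution). [folklore] -/
theorem exists_heatForced_Icc {a b : ℝ} (hab : a < b) {f : ℝ → UnitAddTorus d → ℝ}
    (hf : IsSmoothSpaceTimeOn (Icc a b) f) :
    ∃ θ : ℝ → UnitAddTorus d → ℝ, IsSmoothSpaceTimeOn (Icc a b) θ ∧
      (∀ t ∈ Icc a b, ∀ x, timeDerivWithin (Icc a b) θ t x = laplacian (θ t) x + f t x) ∧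
      θ a = fun _ => 0 := by
  set T : ℝ := b - a with hT_def
  have hT : 0 < T := sub_pos.2 hab
  -- translate the forcing to `[0, T]`
  set s : ℝ → UnitAddTorus d → ℝ := fun t => f (t + a) with hs_def
  have hpre : (· + a) ⁻¹' Icc a b = Icc 0 T := by
    rw [preimage_add_const_Icc', sub_self, hT_def]
  have hs : IsSmoothSpaceTimeOn (Icc 0 T) s := by
    have h := hf.comp_add_const a
    rwa [hpre] at h
  have hu : IsSmoothSpaceTimeOn (Icc 0 T) (fun (_ : ℝ) (_ : UnitAddTorus d) => (0 : EuclideanSpace ℝ d)) :=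
    FunctionSpaces.Torus.isSmoothSpaceTimeOn_const (FunctionSpaces.Torus.isSmooth_const _) _
  have hdiv : ∀ t ∈ Icc 0 T, FunctionSpaces.Torus.IsDivFree
      ((fun (_ : ℝ) (_ : UnitAddTorus d) => (0 : EuclideanSpace ℝ d)) t) := fun t _ x => by
    simp [FunctionSpaces.Torus.divergence, FunctionSpaces.Torus.partialDeriv,
      FunctionSpaces.Torus.lineDeriv]
  obtain ⟨θ₀, hθ₀, hθ₀0, -⟩ := exists_unique_isClassicalScalarTransportForcedOn_holds (d := d)
    one_pos hT hu hdiv hs (FunctionSpaces.Torus.isSmooth_const (0 : ℝ))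
  -- translate the solution back to `[a, b]`
  refine ⟨fun t => θ₀ (t + -a), ?_, fun t ht x => ?_, ?_⟩
  · have h := hθ₀.smooth_scalar.comp_add_const (-a)
    have hpre' : (· + -a) ⁻¹' Icc 0 T = Icc a b := by
      rw [preimage_add_const_Icc', hT_def]; congr 1 <;> ring
    rwa [hpre'] at h
  · have hpre' : (· + -a) ⁻¹' Icc 0 T = Icc a b := by
      rw [preimage_add_const_Icc', hT_def]; congr 1 <;> ring
    have h1 := timeDerivWithin_comp_add_const (Icc 0 T) θ₀ (-a) t x
    rw [hpre'] at h1
    rw [h1]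
    have ht' : t + -a ∈ Icc 0 T := ⟨by linarith [ht.1], by rw [hT_def]; linarith [ht.2]⟩
    have h2 := hθ₀.transport (t + -a) ht' x
    simp only [inner_zero_left, add_zero, one_mul] at h2
    rw [h2, hs_def]
    simp
  · funext x
    have := congrFun hθ₀0 x
    simpa using this

/-- A classical solution of `∂ₜθ = Δθ + f` on `[a, b] × 𝕋^d`, translated to `[0, b - a]`, is a
classical forced advection–diffusion solution with zero drift and `κ = 1`. [folklore] -/
theorem isClassicalScalarTransportForcedOn_translate {a b : ℝ} {f θ : ℝ → UnitAddTorus d → ℝ}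
    (hf : IsSmoothSpaceTimeOn (Icc a b) f) (hθ : IsSmoothSpaceTimeOn (Icc a b) θ)
    (heq : ∀ t ∈ Icc a b, ∀ x, timeDerivWithin (Icc a b) θ t x = laplacian (θ t) x + f t x) :
    IsClassicalScalarTransportForcedOn (Icc 0 (b - a)) 1 (fun _ _ => 0) (fun t => f (t + a))
      (fun t => θ (t + a)) := by
  have hpre : (· + a) ⁻¹' Icc a b = Icc 0 (b - a) := by
    rw [preimage_add_const_Icc', sub_self]
  refine ⟨FunctionSpaces.Torus.isSmoothSpaceTimeOn_const (FunctionSpaces.Torus.isSmooth_const _) _,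
    ?_, ?_, fun t ht x => ?_, fun t _ x => ?_⟩
  · have h := hf.comp_add_const a
    rwa [hpre] at h
  · have h := hθ.comp_add_const a
    rwa [hpre] at h
  · have h1 := timeDerivWithin_comp_add_const (Icc a b) θ a t x
    rw [hpre] at h1
    rw [h1, inner_zero_left, add_zero, one_mul]
    exact heq (t + a) ⟨by linarith [ht.1], by linarith [ht.2]⟩ x
  · simp [FunctionSpaces.Torus.divergence, FunctionSpaces.Torus.partialDeriv,
      FunctionSpaces.Torus.lineDeriv]

/-- **Uniqueness for the forced heat equation on `[a, b] × 𝕋^d`**: two classical solutions of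
`∂ₜθ = Δθ + f` with the same value at `t = a` agree on `[a, b]` (translate to `[0, b - a]` and
apply `Torus.IsClassicalScalarTransportForcedOn.eq_on_Icc`, the energy identity). [folklore] -/
theorem heatForced_unique_Icc {a b : ℝ} (hab : a < b) {f θ₁ θ₂ : ℝ → UnitAddTorus d → ℝ}
    (hf : IsSmoothSpaceTimeOn (Icc a b) f) (h₁ : IsSmoothSpaceTimeOn (Icc a b) θ₁)
    (h₂ : IsSmoothSpaceTimeOn (Icc a b) θ₂)
    (heq₁ : ∀ t ∈ Icc a b, ∀ x, timeDerivWithin (Icc a b) θ₁ t x = laplacian (θ₁ t) x + f t x)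
    (heq₂ : ∀ t ∈ Icc a b, ∀ x, timeDerivWithin (Icc a b) θ₂ t x = laplacian (θ₂ t) x + f t x)
    (h0 : θ₁ a = θ₂ a) : ∀ t ∈ Icc a b, θ₁ t = θ₂ t := by
  have hT : 0 < b - a := sub_pos.2 hab
  have c₁ := isClassicalScalarTransportForcedOn_translate hf h₁ heq₁
  have c₂ := isClassicalScalarTransportForcedOn_translate hf h₂ heq₂
  have h0' : (fun t => θ₁ (t + a)) 0 = (fun t => θ₂ (t + a)) 0 := by simpa using h0
  intro t ht
  have h := IsClassicalScalarTransportForcedOn.eq_on_Icc one_pos hT c₁ c₂ h0' (t - a)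
    ⟨by linarith [ht.1], by linarith [ht.2]⟩
  simpa using h

omit [DecidableEq d] in
/-- **The coefficient ODE of a classical heat solution.** If `∂ₜθ = Δθ + f` on `[a, b] × 𝕋^d`
(`a < b`, `θ`, `f` jointly smooth), then for every frequency `k` the Fourier coefficient
`c(t) = 𝓕(θ(t))(k)` of the complexified solution satisfies `c' = -4π²|k|² c + 𝓕(f(t))(k)`
within `[a, b]` (`d/dt 𝓕(θ(t)) = 𝓕(∂ₜθ(t))`, tree `ScalarFourier.hasDerivWithinAt_mFourierCoeff`;
`𝓕(Δθ) = -4π²|k|² 𝓕θ`, Grafakos 2014, Prop. 3.2.6 (8)). [folklore] -/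
theorem hasDerivWithinAt_mFourierCoeff_heatForced [DecidableEq d] {a b : ℝ} (hab : a < b)
    {f θ : ℝ → UnitAddTorus d → ℝ} (hf : IsSmoothSpaceTimeOn (Icc a b) f)
    (hθ : IsSmoothSpaceTimeOn (Icc a b) θ)
    (heq : ∀ t ∈ Icc a b, ∀ x, timeDerivWithin (Icc a b) θ t x = laplacian (θ t) x + f t x)
    (k : d → ℤ) {t : ℝ} (ht : t ∈ Icc a b) :
    HasDerivWithinAt (fun s => mFourierCoeff (fun y => (θ s y : ℂ)) k)
      (-((4 * Real.pi ^ 2 * freqNormSq k : ℝ) : ℂ) * mFourierCoeff (fun y => (θ t y : ℂ)) k +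
        mFourierCoeff (fun y => (f t y : ℂ)) k) (Icc a b) t := by
  have hU : UniqueDiffOn ℝ (Icc a b) := uniqueDiffOn_Icc hab
  have hθC : IsSmoothSpaceTimeOn (Icc a b) (fun s y => (θ s y : ℂ)) := hθ.ofReal
  have h := ScalarFourier.hasDerivWithinAt_mFourierCoeff hθC (convex_Icc a b) hU ht k
  -- identify `𝓕(∂ₜθ(t)) = -4π²|k|² 𝓕(θ(t)) + 𝓕(f(t))`
  have hθt : IsSmooth (θ t) := hθ.isSmooth_slice ht
  have hft : IsSmooth (f t) := hf.isSmooth_slice ht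
  have hder : timeDerivWithin (Icc a b) (fun s y => (θ s y : ℂ)) t =
      (fun y => ((laplacian (θ t) y : ℝ) : ℂ)) + fun y => ((f t y : ℝ) : ℂ) := by
    funext y
    rw [timeDerivWithin_ofReal hθ hU ht y, heq t ht y, Complex.ofReal_add]
    rfl
  have hlap : (fun y => ((laplacian (θ t) y : ℝ) : ℂ)) = laplacian (fun y => (θ t y : ℂ)) :=
    funext fun y => (laplacian_ofReal hθt y).symm
  have hi1 : Integrable (fun y => ((laplacian (θ t) y : ℝ) : ℂ)) volume :=
    (Complex.continuous_ofReal.comp hθt.laplacian.continuous).integrable_unitAddTorus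
  have hi2 : Integrable (fun y => ((f t y : ℝ) : ℂ)) volume :=
    (Complex.continuous_ofReal.comp hft.continuous).integrable_unitAddTorus
  rw [hder, FunctionSpaces.Torus.mFourierCoeff_add hi1 hi2, hlap,
    ScalarFourier.mFourierCoeff_laplacian (g := fun y => ((θ t y : ℝ) : ℂ))
      (hθt.comp_clm Complex.ofRealCLM)] at h
  exact h

end Heat

/-! ## Spatial means of jointly smooth fields are smooth in time -/

section Mean

variable {F : Type*} [NormedAddCommGroup F] [NormedSpace ℝ F]

/-- The spatial mean `t ↦ ∫ θ(t, y) dy` of a field jointly smooth on `[a, b] × 𝕋^d` (`a < b`) is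
`C^n` on `[a, b]` for every `n`, with `derivWithin` the mean of `∂ₜθ` (differentiation under the
integral, tree `Torus.IsSmoothSpaceTimeOn.hasDerivWithinAt_integral`, iterated). [folklore] -/
theorem contDiffOn_integral_slice {a b : ℝ} (hab : a < b) (n : ℕ) :
    ∀ {θ : ℝ → UnitAddTorus d → F}, IsSmoothSpaceTimeOn (Icc a b) θ →
      ContDiffOn ℝ n (fun t => ∫ y, θ t y) (Icc a b) := by
  have hU : UniqueDiffOn ℝ (Icc a b) := uniqueDiffOn_Icc hab
  induction n with
  | zero =>
    intro θ hθ
    exact contDiffOn_zero.2 (hθ.continuousOn_integral (convex_Icc a b))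
  | succ n ih =>
    intro θ hθ
    have hder : ∀ t ∈ Icc a b, HasDerivWithinAt (fun s => ∫ y, θ s y)
        (∫ y, timeDerivWithin (Icc a b) θ t y) (Icc a b) t := fun t ht =>
      hθ.hasDerivWithinAt_integral (convex_Icc a b) ht
    rw [show ((n + 1 : ℕ) : WithTop ℕ∞) = (n : WithTop ℕ∞) + 1 by push_cast; rfl,
      contDiffOn_succ_iff_derivWithin hU]
    refine ⟨fun t ht => (hder t ht).differentiableWithinAt, by simp, ?_⟩
    have h1 : ContDiffOn ℝ n (fun t => ∫ y, timeDerivWithin (Icc a b) θ t y) (Icc a b) :=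
      ih (hθ.timeDerivWithin hU)
    exact h1.congr fun t ht => (hder t ht).derivWithin (hU t ht)

/-- **The spatial mean of a jointly smooth field is a jointly smooth (space-independent) field**
on `[a, b]`, `a < b`. [folklore] -/
theorem _root_.Literature.Analysis.FunctionSpaces.Torus.IsSmoothSpaceTimeOn.integral_slice
    {a b : ℝ} (hab : a < b) {θ : ℝ → UnitAddTorus d → F} (hθ : IsSmoothSpaceTimeOn (Icc a b) θ) :
    IsSmoothSpaceTimeOn (Icc a b) (fun t (_ : UnitAddTorus d) => ∫ y, θ t y) := by
  have h : ContDiffOn ℝ ∞ (fun t => ∫ y, θ t y) (Icc a b) :=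
    contDiffOn_infty.2 fun n => contDiffOn_integral_slice hab n hθ
  change ContDiffOn ℝ ∞ ((fun t => ∫ y, θ t y) ∘ Prod.fst) (Icc a b ×ˢ (univ : Set (EuclideanSpace ℝ d)))
  exact h.comp contDiff_fst.contDiffOn fun z hz => hz.1

end Mean

end Torus

end Literature.Analysis.FluidPDE
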